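import Mathlib
import Summits.Ventures.HodgeRepro2.T5WedgeRank

/-!
# T5CurvePullbackWedge — the two easy halves of the Castelnuovo–de Franchis dichotomy

Tier-5 support for sub-step N1 (Hodge-theoretic side; memo route/T5-N1-hodge-p6.md §H7, Lemma
H7.1 (⇐)): «in case (i) the wedge of two proportional 1-forms vanishes; in case (ii)
`v_a ∧ v_b = k^*(α_a ∧ α_b)` and `α_a ∧ α_b` is a holomorphic 2-form on a curve, hence `0`».
Both halves are recorded at the chart level, in the coefficient model of `T5WedgeRank` (a (1,0)-
covector on a chart `ℂ²` is its coefficient vector `Fin 2 → ℂ`, and `wedge10 u v` is the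
coefficient of `u ∧ v` on `dz_1 ∧ dz_2`):

* case (i): `wedge10_eq_zero_of_smul_add_smul_eq_zero` — ℂ-linearly dependent covectors have zero
  wedge (pointwise; a global linear relation `λ v_a + μ v_b = 0` is a pointwise one);
* case (ii): a covector on the curve (`L : ℂ →L[ℂ] ℂ`) is a multiple of the identity
  (`clm_complex_eq_smul_id`), so its pull-back `L ∘ dk_z` through `k : ℂ² → ℂ` is a multiple of
  `dk_z` (`comp_fderiv_eq_smul`); two such pull-backs are proportional and their wedge vanishes
  (`wedge10_comp_fderiv`, and in the coefficient form `a(w) dw`: `wedge10_pullback_curve`).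

Blind lane (cell pub-hodge-repro2): `import Mathlib` + own `T5WedgeRank`, 0 sorry, standard axioms.
-/

namespace Summit.Ventures.HodgeRepro2.T5CurvePullbackWedge

open Summit.Ventures.HodgeRepro2.T5WedgeRank

/-- `wedge10` is linear in the first argument (scalars). -/
theorem wedge10_smul_left (c : ℂ) (u v : Fin 2 → ℂ) : wedge10 (c • u) v = c * wedge10 u v := by
  simp only [wedge10, Pi.smul_apply, smul_eq_mul]
  ring

/-- `wedge10` is linear in the second argument (scalars). -/
theorem wedge10_smul_right (c : ℂ) (u v : Fin 2 → ℂ) : wedge10 u (c • v) = c * wedge10 u v := by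
  simp only [wedge10, Pi.smul_apply, smul_eq_mul]
  ring

/-- `wedge10` is additive in the first argument. -/
theorem wedge10_add_left (u u' v : Fin 2 → ℂ) :
    wedge10 (u + u') v = wedge10 u v + wedge10 u' v := by
  simp only [wedge10, Pi.add_apply]
  ring

/-- `wedge10` is additive in the second argument. -/
theorem wedge10_add_right (u v v' : Fin 2 → ℂ) :
    wedge10 u (v + v') = wedge10 u v + wedge10 u v' := by
  simp only [wedge10, Pi.add_apply]
  ring

/-- `u ∧ u = 0`. -/
theorem wedge10_self (u : Fin 2 → ℂ) : wedge10 u u = 0 := by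
  simp only [wedge10]
  ring

/-- `wedge10 u 0 = 0`. -/
theorem wedge10_zero_right (u : Fin 2 → ℂ) : wedge10 u 0 = 0 := by
  simp only [wedge10, Pi.zero_apply, mul_zero, sub_zero]

/-- `wedge10 0 v = 0`. -/
theorem wedge10_zero_left (v : Fin 2 → ℂ) : wedge10 0 v = 0 := by
  simp only [wedge10, Pi.zero_apply, zero_mul, sub_zero]

/-- Two multiples of the same covector have zero wedge. -/
theorem wedge10_smul_smul (c d : ℂ) (w : Fin 2 → ℂ) : wedge10 (c • w) (d • w) = 0 := by
  rw [wedge10_smul_left, wedge10_smul_right, wedge10_self, mul_zero, mul_zero]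

/-- Case (i) of Lemma H7.1 (⇐): if `a • u + b • v = 0` with `(a, b) ≠ (0, 0)` — the covectors are
ℂ-linearly dependent — then `u ∧ v = 0`.  (A global relation `λ v_a + μ v_b = 0` between the two
1-forms holds at every point, so the wedge vanishes identically.) -/
theorem wedge10_eq_zero_of_smul_add_smul_eq_zero {u v : Fin 2 → ℂ} {a b : ℂ}
    (hab : a ≠ 0 ∨ b ≠ 0) (h : a • u + b • v = 0) : wedge10 u v = 0 := by
  rcases hab with ha | hb
  · have hu : u = (-(b / a)) • v := by
      have h' : a • u = -(b • v) := eq_neg_of_add_eq_zero_left h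
      calc u = a⁻¹ • (a • u) := by rw [smul_smul, inv_mul_cancel₀ ha, one_smul]
        _ = (-(b / a)) • v := by rw [h', smul_neg, smul_smul, neg_smul, div_eq_inv_mul]
    rw [hu, wedge10_smul_left, wedge10_self, mul_zero]
  · have hv : v = (-(a / b)) • u := by
      have h' : b • v = -(a • u) := eq_neg_of_add_eq_zero_right h
      calc v = b⁻¹ • (b • v) := by rw [smul_smul, inv_mul_cancel₀ hb, one_smul]
        _ = (-(a / b)) • u := by rw [h', smul_neg, smul_smul, neg_smul, div_eq_inv_mul]
    rw [hv, wedge10_smul_right, wedge10_self, mul_zero]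

/-- The same, for two covector FIELDS on a chart satisfying one global linear relation on a set
`U`: their wedge vanishes at every point of `U`. -/
theorem wedge10_eq_zero_on_of_smul_add_smul_eq_zero {G : Type*} {u v : G → Fin 2 → ℂ} {a b : ℂ}
    (hab : a ≠ 0 ∨ b ≠ 0) {U : Set G} (h : ∀ z ∈ U, a • u z + b • v z = 0) :
    ∀ z ∈ U, wedge10 (u z) (v z) = 0 :=
  fun z hz => wedge10_eq_zero_of_smul_add_smul_eq_zero hab (h z hz)

/-- Scalar multiples of a ℂ-valued continuous linear map, evaluated: `(c • f) x = c * f x`. -/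
theorem clm_smul_apply {G : Type*} [NormedAddCommGroup G] [NormedSpace ℂ G] (c : ℂ)
    (f : G →L[ℂ] ℂ) (x : G) : (c • f) x = c * f x := rfl

/-- A ℂ-valued continuous linear map on `ℂ` is determined by its value at `1`: `L x = L 1 * x`. -/
theorem clm_complex_apply (L : ℂ →L[ℂ] ℂ) (x : ℂ) : L x = L 1 * x := by
  calc L x = L (x • (1 : ℂ)) := by rw [smul_eq_mul, mul_one]
    _ = x * L 1 := by rw [map_smul, smul_eq_mul]
    _ = L 1 * x := mul_comm _ _

/-- A continuous linear covector on the curve chart `ℂ` is a multiple of the identity: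
`L = L(1) • id` (the 1-forms on a curve are `a(w) dw`). -/
theorem clm_complex_eq_smul_id (L : ℂ →L[ℂ] ℂ) :
    L = L 1 • (ContinuousLinearMap.id ℂ ℂ) :=
  ContinuousLinearMap.ext fun x => by
    rw [clm_smul_apply, ContinuousLinearMap.id_apply, clm_complex_apply]

/-- The pull-back of a covector `L` on the curve through `k : G → ℂ` at `z` — the composite
`L ∘ dk_z` — is the multiple `L(1) • dk_z` of the differential of `k`. -/
theorem comp_fderiv_eq_smul {G : Type*} [NormedAddCommGroup G] [NormedSpace ℂ G]
    (L : ℂ →L[ℂ] ℂ) (k : G → ℂ) (z : G) :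
    L.comp (fderiv ℂ k z) = L 1 • fderiv ℂ k z :=
  ContinuousLinearMap.ext fun x => by
    rw [ContinuousLinearMap.comp_apply, clm_smul_apply, clm_complex_apply]

/-- Case (ii) of Lemma H7.1 (⇐), covector form: two covectors `L, L'` on the curve pulled back
through `k : ℂ² → ℂ` at `z` have zero wedge — both pull-backs are multiples of `dk_z`
(`k^*(α_a ∧ α_b) = k^*α_a ∧ k^*α_b = 0`). -/
theorem wedge10_comp_fderiv (L L' : ℂ →L[ℂ] ℂ) (k : (Fin 2 → ℂ) → ℂ) (z : Fin 2 → ℂ) :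
    wedge10 (fun i => (L.comp (fderiv ℂ k z)) (Pi.single i 1))
      (fun i => (L'.comp (fderiv ℂ k z)) (Pi.single i 1)) = 0 := by
  rw [comp_fderiv_eq_smul, comp_fderiv_eq_smul]
  simp only [clm_smul_apply, wedge10]
  ring

/-- Case (ii) of Lemma H7.1 (⇐), coefficient form: the 1-forms `a(w) dw`, `b(w) dw` on the curve
pull back through `k` to the covector fields `z ↦ a(k z) • dk_z`, `z ↦ b(k z) • dk_z`, whose
wedge vanishes at every point. -/
theorem wedge10_pullback_curve (a b : ℂ → ℂ) (k : (Fin 2 → ℂ) → ℂ) (z : Fin 2 → ℂ) :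
    wedge10 (fun i => a (k z) * fderiv ℂ k z (Pi.single i 1))
      (fun i => b (k z) * fderiv ℂ k z (Pi.single i 1)) = 0 := by
  simp only [wedge10]
  ring

/-- The coefficient vector of `a(k z) • dk_z` is `a(k z)` times the coefficient vector of `dk_z`;
so `wedge10_pullback_curve` is an instance of `wedge10_smul_smul`. -/
theorem wedge10_pullback_curve' (a b : ℂ → ℂ) (k : (Fin 2 → ℂ) → ℂ) (z : Fin 2 → ℂ) :
    wedge10 (a (k z) • fun i => fderiv ℂ k z (Pi.single i 1))
      (b (k z) • fun i => fderiv ℂ k z (Pi.single i 1)) = 0 :=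
  wedge10_smul_smul _ _ _

end Summit.Ventures.HodgeRepro2.T5CurvePullbackWedge
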